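import Summits.ResolutionOfSingularities.ResolutionOfSingularities.Theorems.FrobeniusLadderFInjectiveMacaulayficationGermForm
import Summits.ResolutionOfSingularities.ResolutionOfSingularities.Theorems.FrobeniusLadderFInjectiveMacaulayficationAdmissibleLocalCentre
import Summits.ResolutionOfSingularities.ResolutionOfSingularities.Theorems.FrobeniusLadderFInjectiveMacaulayficationHypersurfacePointBlowup
import Literature.AlgebraicGeometry.Resolution.AlterationsNormalFormBlowupFormal
import Literature.AlgebraicGeometry.Resolution.KollarBlowupSequenceFunctors
import Literature.AlgebraicGeometry.Resolution.AffineBlowupUniversal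
import Literature.AlgebraicGeometry.Resolution.AffineBlowupIntegral
import Literature.AlgebraicGeometry.Resolution.PrincipalizationFromMacaulayfication
import Literature.AlgebraicGeometry.Resolution.CohenMacaulaySystemsOfParameters
import HarnessLib

/-!
# GERM INSTANCES FROM GLOBAL BLOW-UPS: a global blowing up FULL over the generizations of `x` certifies `GermForm.FInjectivizationGermAt p x`
# (crux `FInjectiveMacaulayfication` stmt-ResolutionOfSingularities-15315, chain w45a; res-L1-w45a-plan-1 GO 02:37:11Z on res-L1-w45a-stub-1 g9's
# OFFER (B) «GERM INSTANCES IN EXACT CURRENCY», FILE 1; res-L1-w45a-tri-2 #348 (b)/(d); seat res-L1-w45a-stub-1 g9)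

[OURS · L1 W4.5a] Support file (`--supports stmt-ResolutionOfSingularities-15315 --as helper`); replaces the role of NO printed item; NOT a
statement of the manuscript; def-free, unconditional; NOT in the cone of door v36.2's `_proof`. AI-written (AI review is weaker than expert review).

## What is here — the CERTIFICATE INTERFACE for the F-half's germ form
`GermForm.FInjectivizationGermAt p x` (res-L1-w45a-stub-1 g8, p596392) asks for an ideal sheaf `𝓚 ≠ ⊥` ON `Spec 𝒪_{X,x}`, cosupported at the closed
point, all of whose blowings up are FULL everywhere. Certificates (chart computations, Fedder / Jacobian data) live on a GLOBAL affine model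
`π : X′ → X`. This file moves them down to the germ:

* §1 `fInjectivizationGermAt_of_isBlowup` — **the bridge**: if `π : X′ → X` is a blowing up along `J` with `J|_{Spec 𝒪_{X,x}} ≠ ⊥`,
  `supp J ∩ {generizations of x} ⊆ {x}`, and `X′` is FULL at every point lying over a generization of `x`, then `FInjectivizationGermAt p x`.
  Proof: base change along the flat pro-open immersion `Spec 𝒪_{X,x} → X` (`IsBlowup.pullback_snd_of_flat`, `flat_fromSpecStalk`: blow-ups commute
  with flat base change, GW Prop. 13.91 (2)); the projection `X′ ×_X Spec 𝒪_{X,x} → X′` induces isomorphisms on local rings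
  (`isIso_stalkMap_pullback_fst_fromSpecStalk`), so FULL transports; then `GermForm.fInjectivizationGermAt_of_model`.
  `fInjectivizationGermAt_of_isBlowup_of_ne_bot` — the same with `J ≠ ⊥` on an INTEGRAL `X` (`comap_fromSpecStalk_ne_bot`).
* §2 transport of the germ form's HYPOTHESES from global data: `regularLocus_Spec_stalk_of_isolated` (`Spec 𝒪_{X,x}` is regular off its closed
  point iff `X` is regular at every proper generization of `x`), `cmCl_Spec_stalk_of_generizations` / `cmCl_Spec_stalk_of_isolated` (the CM-clause
  at every point of `Spec 𝒪_{X,x}` from the CM-clause of `𝒪_{X,x}` and regularity at the proper generizations).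
* §3 `fInjectivizationGermAt_of_affineBlowup` — the affine form: `R` a domain, `I ≠ ⊥`, a point `x ∈ Spec R` with `x ⊆ √I` (so `V(I) ⊆ {x}` among the
  generizations of `x`), and `Bl_I(Spec R) = affineBlowup I` FULL at every point ⇒ `FInjectivizationGermAt p x` (`affineBlowup.isBlowup`,
  `affineBlowup.support_idealSheaf`, `affineBlowup.isIntegral`).
* §4 `hypersurfacePointBlowup_fullCl` — the explicit-model twin of the line's engine `HypersurfacePointBlowup.hypersurfacePointBlowupFiModel`
  (res-L1-w45a-lead-1, c7): same certificates (prime `f`, strict transforms `gᵢ` with `θᵢ f = Xᵢ^μ gᵢ`, `R_P` regular off the origin, CM + F clause of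
  the chart hypersurfaces `k[X]/(gᵢ)` at their maximal ideals on the exceptional divisor — Jacobian OR Fedder-type data, so SINGULAR-but-FULL models
  are admitted, res-L1-w45a-tri-2 #348 (d)), conclusion: the point blow-up `affineBlowup (x̄₀,…,x̄_{n−1})` is FULL at EVERY point — and
  **`fInjectivizationGermAt_origin_of_hypersurfacePointBlowup`**: hence `FInjectivizationGermAt p x₀` at the origin `x₀` of `Spec k[X]/(f)`.
  `not_mem_regularLocus_Spec_of_not_isRegularLocalRing`, `cmCl_stalk_Spec_of_cmCl_localization` — the origin's non-regularity / CM-clause in scheme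
  vocabulary from the ring-level statements.

[folklore; cite: GortzWedhorn2020, Prop. 13.91 (2) (flat base change of blow-ups), (13.19) (uniqueness); Temkin2008, §2.1 (pro-open
pro-subschemes `Spec 𝒪_{X,x} ×_X X′`); StacksProject, Tag 0805, Tag 01J7, Tag 0804]
-/

-- single-problem summit: the doubled namespace component is forced
set_option linter.dupNamespace false

noncomputable section

open AlgebraicGeometry CategoryTheory CategoryTheory.Limits Literature.AlgebraicGeometry.Resolution TopologicalSpace IsLocalRing

namespace Summit.ResolutionOfSingularities.ResolutionOfSingularities.Theorems.FInjectiveMacaulayfication.GermOfGlobalBlowup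

open Summit.ResolutionOfSingularities.ResolutionOfSingularities.Theorems.FInjectiveMacaulayfication
open SliceableCentre GermForm

/-! ## §0 Plumbing on `Spec 𝒪_{X,x} → X` -/

/-- Every point of `Spec 𝒪_{X,x}` maps to a generization of `x`. [cite: StacksProject, Tag 01J7] -/
theorem fromSpecStalk_specializes {X : Scheme.{0}} (x : X) (s : Spec (X.presheaf.stalk x)) :
    X.fromSpecStalk x s ⤳ x := by
  have h : X.fromSpecStalk x s ∈ Set.range (X.fromSpecStalk x) := ⟨s, rfl⟩
  rw [Scheme.range_fromSpecStalk] at h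
  exact h

/-- The only point of `Spec 𝒪_{X,x}` over `x` is the closed point (`Spec 𝒪_{X,x} → X` is a topological embedding). [cite: StacksProject, Tag 01J7] -/
theorem eq_closedPoint_of_fromSpecStalk_eq {X : Scheme.{0}} (x : X) (s : Spec (X.presheaf.stalk x))
    (hs : X.fromSpecStalk x s = x) : s = closedPoint (X.presheaf.stalk x) := by
  apply (X.fromSpecStalk x).isEmbedding.injective
  rw [hs, Scheme.fromSpecStalk_closedPoint]

/-- On an affine scheme, the ideal sheaf of a non-zero ideal of global sections is non-zero. [plumbing] -/
theorem ofIdealTop_ne_bot {Y : Scheme.{0}} [IsAffine Y] {I₀ : Ideal Γ(Y, ⊤)} (h : I₀ ≠ ⊥) :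
    Scheme.IdealSheafData.ofIdealTop I₀ ≠ ⊥ := by
  intro hbot
  apply h
  have h' := ideal_ofIdealTop_top I₀
  rw [hbot, Scheme.IdealSheafData.ideal_bot, Pi.bot_apply] at h'
  exact h'.symm

/-- **On an integral scheme a non-zero ideal sheaf restricts to a non-zero ideal sheaf on `Spec 𝒪_{X,x}`**: the restriction is the ideal sheaf of the
stalk `J_x` (`comap_fromSpecStalk_eq_ofIdealTop`), and `J_x ≠ 0` (`stalkIdeal_ne_bot_of_ne_bot`). [folklore] -/
theorem comap_fromSpecStalk_ne_bot {X : Scheme.{0}} [IsIntegral X] {J : X.IdealSheafData} (hJ : J ≠ ⊥) (x : X) :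
    J.comap (X.fromSpecStalk x) ≠ ⊥ := by
  rw [comap_fromSpecStalk_eq_ofIdealTop x J]
  refine ofIdealTop_ne_bot fun h => stalkIdeal_ne_bot_of_ne_bot hJ x ?_
  exact (Ideal.map_eq_bot_iff_of_injective
    (Scheme.ΓSpecIso (X.presheaf.stalk x)).commRingCatIsoToRingEquiv.symm.injective).mp h

/-- If the support of `J` meets the generizations of `x` only in `x`, then `J|_{Spec 𝒪_{X,x}}` is cosupported at the closed point. [folklore] -/
theorem support_comap_fromSpecStalk_subset_closedPoint {X : Scheme.{0}} (J : X.IdealSheafData) (x : X)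
    (hsupp : ∀ y ∈ (J.support : Set X), y ⤳ x → y = x) :
    ∀ s ∈ ((J.comap (X.fromSpecStalk x)).support : Set (Spec (X.presheaf.stalk x))), s = closedPoint (X.presheaf.stalk x) := by
  intro s hs
  rw [Scheme.IdealSheafData.support_comap] at hs
  exact eq_closedPoint_of_fromSpecStalk_eq x s (hsupp _ hs (fromSpecStalk_specializes x s))

/-! ## §1 The bridge: a global blowing up FULL over the generizations of `x` ⇒ `FInjectivizationGermAt p x` -/

/-- **GERM CERTIFICATE FROM A GLOBAL BLOW-UP.** Let `π : X′ → X` be a blowing up along `J` such that (i) `J|_{Spec 𝒪_{X,x}} ≠ ⊥`, (ii) every point of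
`supp J` that is a generization of `x` equals `x`, and (iii) `X′` is FULL at every point lying over a generization of `x`. Then `FInjectivizationGermAt p x`:
the base change `X′ ×_X Spec 𝒪_{X,x} → Spec 𝒪_{X,x}` is a blowing up along `J|_{Spec 𝒪_{X,x}}` (flat base change), cosupported at the closed point by (ii),
and FULL everywhere because its local rings are local rings of `X′` at points over generizations of `x`.
[folklore; cite: GortzWedhorn2020, Prop. 13.91 (2); Temkin2008, §2.1] -/
theorem fInjectivizationGermAt_of_isBlowup (p : ℕ) {X X' : Scheme.{0}} (x : X) {π : X' ⟶ X} {J : X.IdealSheafData}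
    (hπ : IsBlowup π J) (hJx : J.comap (X.fromSpecStalk x) ≠ ⊥)
    (hsupp : ∀ y ∈ (J.support : Set X), y ⤳ x → y = x)
    (hfull : ∀ x' : X', π.base x' ⤳ x → FullCl p (X'.presheaf.stalk x')) :
    FInjectivizationGermAt p x := by
  haveI : Flat (X.fromSpecStalk x) := flat_fromSpecStalk X x
  have hP : IsBlowup (pullback.snd π (X.fromSpecStalk x)) (J.comap (X.fromSpecStalk x)) :=
    hπ.pullback_snd_of_flat (X.fromSpecStalk x)
  refine fInjectivizationGermAt_of_model p x (J.comap (X.fromSpecStalk x)) hJx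
    (support_comap_fromSpecStalk_subset_closedPoint J x hsupp) hP fun s => ?_
  haveI := isIso_stalkMap_pullback_fst_fromSpecStalk π x s
  refine FTemkinClosedPoints.fullCl_of_isIso_stalkMap' p (pullback.fst π (X.fromSpecStalk x)) s (hfull _ ?_)
  have hmem : (pullback.fst π (X.fromSpecStalk x)) s ∈ Set.range (pullback.fst π (X.fromSpecStalk x)) := ⟨s, rfl⟩
  rw [range_pullback_fst_fromSpecStalk] at hmem
  exact hmem

/-- **GERM CERTIFICATE FROM A GLOBAL BLOW-UP, integral base**: on an INTEGRAL `X` hypothesis (i) of `fInjectivizationGermAt_of_isBlowup` reads `J ≠ ⊥`.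
[folklore; cite: GortzWedhorn2020, Prop. 13.91 (2)] -/
theorem fInjectivizationGermAt_of_isBlowup_of_ne_bot (p : ℕ) {X X' : Scheme.{0}} [IsIntegral X] (x : X) {π : X' ⟶ X}
    {J : X.IdealSheafData} (hπ : IsBlowup π J) (hJ : J ≠ ⊥)
    (hsupp : ∀ y ∈ (J.support : Set X), y ⤳ x → y = x)
    (hfull : ∀ x' : X', π.base x' ⤳ x → FullCl p (X'.presheaf.stalk x')) :
    FInjectivizationGermAt p x :=
  fInjectivizationGermAt_of_isBlowup p x hπ (comap_fromSpecStalk_ne_bot hJ x) hsupp hfull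

/-! ## §2 The germ form's hypotheses from global data -/

/-- **`Spec 𝒪_{X,x}` is regular off its closed point if `X` is regular at every proper generization of `x`** (ISOLATEDNESS of the singularity, germ side):
the regular locus of `Spec 𝒪_{X,x}` is the pull-back of that of `X` (`AdmissibleLocalCentre.mem_regularLocus_Spec_stalk_iff`). [folklore; cite: Temkin2008, §2.1] -/
theorem regularLocus_Spec_stalk_of_isolated {X : Scheme.{0}} (x : X)
    (hiso : ∀ y : X, y ⤳ x → y ≠ x → y ∈ Scheme.regularLocus X) :
    ∀ s : Spec (X.presheaf.stalk x), s ≠ closedPoint (X.presheaf.stalk x) → s ∈ Scheme.regularLocus (Spec (X.presheaf.stalk x)) := by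
  intro s hs
  rw [AdmissibleLocalCentre.mem_regularLocus_Spec_stalk_iff]
  exact hiso _ (fromSpecStalk_specializes x s) fun h => hs (eq_closedPoint_of_fromSpecStalk_eq x s h)

/-- **The CM-clause at every point of `Spec 𝒪_{X,x}` from the CM-clause of `X` at every generization of `x`**: the local rings of `Spec 𝒪_{X,x}` are
those of `X` at the image points (`Spec 𝒪_{X,x} → X` is a flat preimmersion, `isIso_stalkMap_of_flat_of_isPreimmersion`). [folklore; cite: Temkin2008, §2.1] -/
theorem cmCl_Spec_stalk_of_generizations {X : Scheme.{0}} (x : X) (hcm : ∀ y : X, y ⤳ x → CMCl (X.presheaf.stalk y)) :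
    ∀ s : Spec (X.presheaf.stalk x), CMCl ((Spec (X.presheaf.stalk x)).presheaf.stalk s) := by
  intro s
  haveI : Flat (X.fromSpecStalk x) := flat_fromSpecStalk X x
  haveI := isIso_stalkMap_of_flat_of_isPreimmersion (X.fromSpecStalk x) s
  exact cmClause_of_ringEquiv (asIso ((X.fromSpecStalk x).stalkMap s)).commRingCatIsoToRingEquiv
    (hcm _ (fromSpecStalk_specializes x s))

/-- **The CM-clause at every point of `Spec 𝒪_{X,x}` for an ISOLATED singularity**: it suffices that `𝒪_{X,x}` satisfies the CM-clause and that `X` is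
regular at every proper generization of `x` (regular local rings are Cohen–Macaulay, `cmClause_of_isRegularLocalRing`). [folklore; cite: BrunsHerzog1993, Cor. 2.2.6] -/
theorem cmCl_Spec_stalk_of_isolated {X : Scheme.{0}} (x : X) (hx : CMCl (X.presheaf.stalk x))
    (hiso : ∀ y : X, y ⤳ x → y ≠ x → y ∈ Scheme.regularLocus X) :
    ∀ s : Spec (X.presheaf.stalk x), CMCl ((Spec (X.presheaf.stalk x)).presheaf.stalk s) := by
  refine cmCl_Spec_stalk_of_generizations x fun y hy => ?_
  by_cases hyx : y = x
  · subst hyx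
    exact hx
  · haveI : IsRegularLocalRing (X.presheaf.stalk y) := hiso y hy hyx
    exact cmClause_of_isRegularLocalRing (X.presheaf.stalk y)

/-! ## §3 The affine form: `Bl_I(Spec R)` FULL everywhere, `V(I) = {x}` near `x` -/

/-- **GERM CERTIFICATE FROM AN AFFINE BLOW-UP.** `R` a domain, `I ≠ ⊥` an ideal, `x ∈ Spec R` a point with `x ⊆ √I` (so a prime containing `I` and
contained in `x` IS `x`), and the blowing up `Bl_I(Spec R) = affineBlowup I` FULL at every point ⇒ `FInjectivizationGermAt p x`. (For the blow-up of a
closed point take `I = x` maximal; for a weighted blow-up `I = I_N ∋ x_v^{c_v}`.) [folklore; cite: GortzWedhorn2020, Prop. 13.91 (2), Prop. 13.92] -/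
theorem fInjectivizationGermAt_of_affineBlowup (p : ℕ) {R : Type} [CommRing R] [IsDomain R] (I : Ideal R) (hI : I ≠ ⊥)
    (x : Spec (.of R)) (hxI : x.asIdeal ≤ I.radical)
    (hfull : ∀ y : ↥(affineBlowup I), FullCl p ((affineBlowup I).presheaf.stalk y)) :
    FInjectivizationGermAt p x := by
  haveI : IsIntegral (affineBlowup I) := affineBlowup.isIntegral hI
  have hπ : IsBlowup (affineBlowup.π I) (affineBlowup.idealSheaf I) := affineBlowup.isBlowup I
  refine fInjectivizationGermAt_of_isBlowup_of_ne_bot p x hπ (RegularBlowupModelDim2.ne_bot_of_isBlowup hπ) ?_ fun y _ => hfull y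
  intro y hy hyx
  rw [affineBlowup.support_idealSheaf] at hy
  have hIy : I ≤ y.asIdeal := fun a ha => hy ha
  have h1 : x.asIdeal ≤ y.asIdeal := hxI.trans (y.2.radical_le_iff.mpr hIy)
  have h2 : y.asIdeal ≤ x.asIdeal := (PrimeSpectrum.le_iff_specializes y x).mpr hyx
  exact PrimeSpectrum.ext (le_antisymm h2 h1)

/-! ## §4 The point blow-up of a hypersurface, explicit model; the origin's germ certificate -/

/-- **The point blow-up of a hypersurface is FULL at EVERY point — explicit model.** Twin of `HypersurfacePointBlowup.hypersurfacePointBlowupFiModel`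
(same certificates; `0 < n`) whose conclusion names the model `affineBlowup (x̄₀, …, x̄_{n−1})` instead of hiding it behind `∃ X′`: `(f)` prime,
`θᵢ f = Xᵢ^μ gᵢ` with `Xᵢ ∤ f`, `Xᵢ ∤ gᵢ`, `R_P` regular at the primes `P ⊉ 𝔪`, and the CM + Frobenius-closed clause of every chart hypersurface `k[X]/(gᵢ)`
at its maximal ideals containing `x̄ᵢ` (Jacobian data at regular points, Fedder-type data at singular ones) ⇒ every stalk of `affineBlowup 𝔪` is FULL.
Proof = the engine's: `AffineBlowupStalkClause.stub_affineBlowupStalkClause` ∘ `StrictTransformChartN.chart_clause_of_presentationN` ∘ `PrimeTransfer`.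
[folklore; cite: StacksProject, Tag 0804; Fedder1983, Thm. 1.12] -/
theorem hypersurfacePointBlowup_fullCl (p : ℕ) [Fact p.Prime] (k : Type) [Field k] [CharP k p] (n : ℕ) (hn : 0 < n)
    (f : MvPolynomial (Fin n) k) (g : Fin n → MvPolynomial (Fin n) k) (μ : ℕ)
    (hfprime : (Ideal.span {f}).IsPrime)
    (hθ : ∀ i : Fin n, MvPolynomial.aeval (fun j : Fin n => if j = i then (MvPolynomial.X i : MvPolynomial (Fin n) k)
        else MvPolynomial.X j * MvPolynomial.X i) f = MvPolynomial.X i ^ μ * g i)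
    (hf : ∀ i : Fin n, f ∉ Ideal.span {(MvPolynomial.X i : MvPolynomial (Fin n) k)})
    (hg : ∀ i : Fin n, g i ∉ Ideal.span {(MvPolynomial.X i : MvPolynomial (Fin n) k)})
    (hoff : ∀ (P : Ideal (MvPolynomial (Fin n) k ⧸ Ideal.span {f})) [P.IsPrime],
      ¬ Ideal.span (Set.range fun j : Fin n => Ideal.Quotient.mk (Ideal.span {f}) (MvPolynomial.X j)) ≤ P →
      IsRegularLocalRing (Localization.AtPrime P))
    (hpts : ∀ (i : Fin n) (Q : Ideal (MvPolynomial (Fin n) k ⧸ Ideal.span {g i})) [Q.IsMaximal],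
      Ideal.Quotient.mk (Ideal.span {g i}) (MvPolynomial.X i) ∈ Q →
      ∀ d : ℕ, ringKrullDim (Localization.AtPrime Q) = d → ∀ s : Fin d → Localization.AtPrime Q,
        (Ideal.span (Set.range s)).radical.IsMaximal →
          RingTheory.Sequence.IsWeaklyRegular (Localization.AtPrime Q) (List.ofFn s) ∧
          ∀ y : Localization.AtPrime Q, (∃ e : ℕ, y ^ p ^ e ∈ Ideal.span
            ((fun z : Localization.AtPrime Q => z ^ p ^ e) ''
              (Ideal.span (Set.range s) : Set (Localization.AtPrime Q)))) → y ∈ Ideal.span (Set.range s)) :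
    ∀ y : ↥(affineBlowup (Ideal.span (Set.range fun j : Fin n => Ideal.Quotient.mk (Ideal.span {f}) (MvPolynomial.X j)))),
      FullCl p ((affineBlowup (Ideal.span (Set.range fun j : Fin n =>
        Ideal.Quotient.mk (Ideal.span {f}) (MvPolynomial.X j)))).presheaf.stalk y) := by
  haveI := hfprime
  haveI : IsDomain (MvPolynomial (Fin n) k ⧸ Ideal.span {f}) := Ideal.Quotient.isDomain _
  haveI : CharP (MvPolynomial (Fin n) k ⧸ Ideal.span {f}) p :=
    charP_of_injective_algebraMap (algebraMap k (MvPolynomial (Fin n) k ⧸ Ideal.span {f})).injective p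
  have hf0 : f ≠ 0 := by
    rintro rfl
    exact hf ⟨0, hn⟩ (Ideal.zero_mem _)
  have hgprime : ∀ i : Fin n, (Ideal.span {g i}).IsPrime := fun i =>
    (PrimeTransfer.stub_primeTransfer k n i f (g i) μ (hθ i) (hf i) (hg i)).mp hfprime
  have hXg : ∀ i : Fin n, (MvPolynomial.X i : MvPolynomial (Fin n) k) ∉ Ideal.span {g i} := fun i =>
    PrimeTransfer.X_not_mem_span_of_isPrime (hgprime i) (hg i)
  have hXf : ∀ i : Fin n, (MvPolynomial.X i : MvPolynomial (Fin n) k) ∉ Ideal.span {f} := fun i =>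
    PrimeTransfer.X_not_mem_span_of_isPrime hfprime (hf i)
  have hxne : ∀ i : Fin n, (fun j : Fin n => Ideal.Quotient.mk (Ideal.span {f}) (MvPolynomial.X j)) i ≠ 0 := fun i h =>
    hXf i (Ideal.Quotient.eq_zero_iff_mem.mp h)
  have hI : Ideal.span (Set.range fun j : Fin n => Ideal.Quotient.mk (Ideal.span {f}) (MvPolynomial.X j)) ≠ ⊥ := fun hbot =>
    hxne ⟨0, hn⟩ ((Ideal.mem_bot).mp (hbot ▸ Ideal.subset_span (Set.mem_range_self _)))
  refine AffineBlowupStalkClause.stub_affineBlowupStalkClause p (MvPolynomial (Fin n) k ⧸ Ideal.span {f})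
    (Ideal.span (Set.range fun j : Fin n => Ideal.Quotient.mk (Ideal.span {f}) (MvPolynomial.X j))) n
    (fun j : Fin n => Ideal.Quotient.mk (Ideal.span {f}) (MvPolynomial.X j))
    (fun i => Ideal.subset_span (Set.mem_range_self i)) rfl hI ?_ ?_
  · -- off the origin `R_P` is regular, hence FULL
    intro P _ hP
    haveI : IsRegularLocalRing (Localization.AtPrime P) := hoff P hP
    haveI : CharP (Localization.AtPrime P) p := DegreeZeroDescent.charP_localization_atPrime p P
    have key := FiClauseOfRegular.stub_fiClauseOfRegular p (Localization.AtPrime P)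
    exact key
  · -- on the exceptional divisor, chart by chart, through the strict-transform presentation
    intro i _ Q hQ huQ
    have key := StrictTransformChartN.chart_clause_of_presentationN p k n f hfprime hf0
      (fun j : Fin n => Ideal.Quotient.mk (Ideal.span {f}) (MvPolynomial.X j)) rfl i (g i) μ
      (hgprime i) (hXg i) (hθ i) (fun Q' _ hQ' => hpts i Q' hQ') Q huQ
    exact key

/-- **THE ORIGIN'S GERM CERTIFICATE for a hypersurface whose point blow-up is FULL.** Under the certificates of `hypersurfacePointBlowup_fullCl`, at the
point `x₀` of `Spec k[X]/(f)` whose prime is `(x̄₀, …, x̄_{n−1})` (the origin; it is a point as soon as `f(0) = 0`): `GermForm.FInjectivizationGermAt p x₀`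
— a CERTIFIED INSTANCE of the F-half's germ-form CONCLUSION at `x₀`. [folklore; cite: GortzWedhorn2020, Prop. 13.91 (2); StacksProject, Tag 0804] -/
theorem fInjectivizationGermAt_origin_of_hypersurfacePointBlowup (p : ℕ) [Fact p.Prime] (k : Type) [Field k] [CharP k p] (n : ℕ)
    (hn : 0 < n) (f : MvPolynomial (Fin n) k) (g : Fin n → MvPolynomial (Fin n) k) (μ : ℕ)
    (hfprime : (Ideal.span {f}).IsPrime)
    (hθ : ∀ i : Fin n, MvPolynomial.aeval (fun j : Fin n => if j = i then (MvPolynomial.X i : MvPolynomial (Fin n) k)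
        else MvPolynomial.X j * MvPolynomial.X i) f = MvPolynomial.X i ^ μ * g i)
    (hf : ∀ i : Fin n, f ∉ Ideal.span {(MvPolynomial.X i : MvPolynomial (Fin n) k)})
    (hg : ∀ i : Fin n, g i ∉ Ideal.span {(MvPolynomial.X i : MvPolynomial (Fin n) k)})
    (hoff : ∀ (P : Ideal (MvPolynomial (Fin n) k ⧸ Ideal.span {f})) [P.IsPrime],
      ¬ Ideal.span (Set.range fun j : Fin n => Ideal.Quotient.mk (Ideal.span {f}) (MvPolynomial.X j)) ≤ P →
      IsRegularLocalRing (Localization.AtPrime P))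
    (hpts : ∀ (i : Fin n) (Q : Ideal (MvPolynomial (Fin n) k ⧸ Ideal.span {g i})) [Q.IsMaximal],
      Ideal.Quotient.mk (Ideal.span {g i}) (MvPolynomial.X i) ∈ Q →
      ∀ d : ℕ, ringKrullDim (Localization.AtPrime Q) = d → ∀ s : Fin d → Localization.AtPrime Q,
        (Ideal.span (Set.range s)).radical.IsMaximal →
          RingTheory.Sequence.IsWeaklyRegular (Localization.AtPrime Q) (List.ofFn s) ∧
          ∀ y : Localization.AtPrime Q, (∃ e : ℕ, y ^ p ^ e ∈ Ideal.span
            ((fun z : Localization.AtPrime Q => z ^ p ^ e) ''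
              (Ideal.span (Set.range s) : Set (Localization.AtPrime Q)))) → y ∈ Ideal.span (Set.range s))
    (x₀ : Spec (.of (MvPolynomial (Fin n) k ⧸ Ideal.span {f})))
    (hx₀ : x₀.asIdeal = Ideal.span (Set.range fun j : Fin n => Ideal.Quotient.mk (Ideal.span {f}) (MvPolynomial.X j))) :
    FInjectivizationGermAt p x₀ := by
  haveI := hfprime
  haveI : IsDomain (MvPolynomial (Fin n) k ⧸ Ideal.span {f}) := Ideal.Quotient.isDomain _
  have hXf : ∀ i : Fin n, (MvPolynomial.X i : MvPolynomial (Fin n) k) ∉ Ideal.span {f} := fun i =>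
    PrimeTransfer.X_not_mem_span_of_isPrime hfprime (hf i)
  have hI : Ideal.span (Set.range fun j : Fin n => Ideal.Quotient.mk (Ideal.span {f}) (MvPolynomial.X j)) ≠ ⊥ := fun hbot =>
    hXf ⟨0, hn⟩ (Ideal.Quotient.eq_zero_iff_mem.mp
      ((Ideal.mem_bot).mp (hbot ▸ Ideal.subset_span (Set.mem_range_self (⟨0, hn⟩ : Fin n)))))
  exact fInjectivizationGermAt_of_affineBlowup p _ hI x₀ (hx₀ ▸ Ideal.le_radical)
    (hypersurfacePointBlowup_fullCl p k n hn f g μ hfprime hθ hf hg hoff hpts)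

/-- **Non-regularity of a point of `Spec R` from the ring side**: `x ∉ Reg (Spec R)` iff `R_x` is not a regular local ring (the stalk of `Spec R` at `x`
is `R_x`). [folklore] -/
theorem not_mem_regularLocus_Spec_of_not_isRegularLocalRing {R : Type} [CommRing R] (x : Spec (.of R))
    (h : ¬ IsRegularLocalRing (Localization.AtPrime x.asIdeal)) : x ∉ Scheme.regularLocus (Spec (.of R)) := by
  intro hx
  apply h
  letI : Algebra R ((Spec (.of R)).presheaf.stalk x) := (StructureSheaf.toStalk R x).hom.toAlgebra
  have hloc : IsLocalization.AtPrime ((Spec (.of R)).presheaf.stalk x) x.asIdeal :=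
    StructureSheaf.IsLocalization.to_stalk R x
  haveI : IsRegularLocalRing ((Spec (.of R)).presheaf.stalk x) := hx
  exact IsRegularLocalRing.of_ringEquiv (IsLocalization.algEquiv x.asIdeal.primeCompl ((Spec (.of R)).presheaf.stalk x)
    (Localization.AtPrime x.asIdeal)).toRingEquiv

/-- **The CM-clause of a stalk of `Spec R` from the ring side**: the stalk at `x` is `R_x`. [folklore] -/
theorem cmCl_stalk_Spec_of_cmCl_localization {R : Type} [CommRing R] (x : Spec (.of R))
    (h : CMCl (Localization.AtPrime x.asIdeal)) : CMCl ((Spec (.of R)).presheaf.stalk x) := by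
  letI : Algebra R ((Spec (.of R)).presheaf.stalk x) := (StructureSheaf.toStalk R x).hom.toAlgebra
  have hloc : IsLocalization.AtPrime ((Spec (.of R)).presheaf.stalk x) x.asIdeal :=
    StructureSheaf.IsLocalization.to_stalk R x
  exact cmClause_of_ringEquiv (IsLocalization.algEquiv x.asIdeal.primeCompl (Localization.AtPrime x.asIdeal)
    ((Spec (.of R)).presheaf.stalk x)).toRingEquiv h

/-- **The local dimension of a stalk of `Spec R` from the ring side.** [folklore] -/
theorem ringKrullDim_stalk_Spec_eq {R : Type} [CommRing R] (x : Spec (.of R)) :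
    ringKrullDim ((Spec (.of R)).presheaf.stalk x) = ringKrullDim (Localization.AtPrime x.asIdeal) := by
  letI : Algebra R ((Spec (.of R)).presheaf.stalk x) := (StructureSheaf.toStalk R x).hom.toAlgebra
  have hloc : IsLocalization.AtPrime ((Spec (.of R)).presheaf.stalk x) x.asIdeal :=
    StructureSheaf.IsLocalization.to_stalk R x
  exact ringKrullDim_eq_of_ringEquiv (IsLocalization.algEquiv x.asIdeal.primeCompl ((Spec (.of R)).presheaf.stalk x)
    (Localization.AtPrime x.asIdeal)).toRingEquiv

end Summit.ResolutionOfSingularities.ResolutionOfSingularities.Theorems.FInjectiveMacaulayfication.GermOfGlobalBlowup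

end
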